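import Summits.ResolutionOfSingularities.ResolutionOfSingularities.Theorems.CoverResolution.Negative.FalseWithoutIsFinite
import Literature.AlgebraicGeometry.Resolution.LogRegularSchemeEtale
import Literature.AlgebraicGeometry.Resolution.ResolutionGlue

/-!
# `CoverResolution` — negative lemmas IV: `IsFinite f` is load-bearing in the child
# `BoundaryLogRegularization` (no Noetherian model near a pinch)

Support (negative) lemmas for crux `stmt-ResolutionOfSingularities-15104`
(`Summit.ResolutionOfSingularities.ResolutionOfSingularities.Theses.CleanCovers.CoverResolution`),
filed by the standing disprover (cdisprove cycle 2, line `strategy-split`; work file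
`Cruxes/CoverResolution/Disproof.lean` §8). The picked line splits the crux into
P1 `BoundaryLogRegularization` (base-local proper birational LOG-REGULAR models along the hyperplane
at infinity), P3 `LogRegularPatching` and P2 `LogRegularResolution` (Nizioł 2006); the assembly and
its converses are landed (`Theorems/CleanCoversCoverResolutionSplit{,Converse}.lean`). This file
shows which hypothesis of P1 is load-bearing and WHY, sharpening the cycle-1 pinch witness
(`Negative/FalseWithoutIsFinite.lean`) from "no resolution" to "no locally Noetherian model at all,
over any base open meeting the pinch":

* `no_noetherianModel_near_pinch` — the affine core, generalized: for a domain `O` with `u ≠ 0`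
  divisible by every power of `v`, NO open `W ↪ Spec O` meeting `V(v)` admits a proper
  `π : Y → W` that is an isomorphism over a dense open and has LOCALLY NOETHERIAN source (regular,
  log regular = toric, or otherwise): Krull's intersection theorem at a point of `Y` over the pinch
  (only Noetherianity of that one stalk is used; cycle 1 used regularity).
* `exists_glued_with_piece` — the gluing of `exists_glued_of_not_hasResolution` with the open
  piece `ι_O : S_O ↪ X` and `ι_O ≫ f = g` exported; `exists_noetherianModel_of_isOpenImmersion` —
  models transport along open immersions into the target.
* `pinch_no_noetherianModel_over_open` — for the pinch ring `O = k[y₁] + y₀·k[y₀,y₁,y₁⁻¹]` glued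
  into ANY `X` as an open piece, any `f : X → T` and any open `B ⊆ T` containing the image of the
  pinch point: `f⁻¹(B)` has no proper birational model with locally Noetherian source.
* `boundaryLogRegularization_false_without_isFinite` — **P1 with `IsFinite f` deleted is FALSE**
  (`p = 2`, `k = 𝔽₂`, `n = 2`, the pinch cover, `h` = the image of the pinch point, which lies on
  `V₊(x₂)`): base-locality (`∃ B ∋ h`) buys nothing, and "log regular" is refuted already through
  its local-Noetherianity clause (`EtaleLogAtlas.IsLogRegular.isLocallyNoetherian`).

Moral for provers of P1 / of the crux: finiteness of `f` enters exactly as Noetherianity (finite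
type) of `X` over the hyperplane at infinity, from dimension `2` on; every MODEL-producing strategy
(resolution, log-regular model, Macaulayfication, …) needs it at the same place. No definitions; no
declaration concludes a route decl positively.

## Sources
* The Stacks Project, Tags 01RN, 02IS, 01JA; H. Matsumura, *Commutative Ring Theory*, Thm. 8.10.
* W. Nizioł, *Toric singularities: log-blow-ups and global resolutions*, J. Algebraic Geom. 15
  (2006), Def. 2.2 (log regular schemes are locally Noetherian by definition).
-/

noncomputable section

set_option linter.dupNamespace false -- mandated namespace of this single-conjunct summit

open CategoryTheory CategoryTheory.Limits AlgebraicGeometry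
open Literature.AlgebraicGeometry.Resolution Literature.AlgebraicGeometry.Motives

namespace Summit.ResolutionOfSingularities.ResolutionOfSingularities.Theorems.CoverResolution.Negative

/-- **No locally Noetherian proper birational model near a pinch.** Let `O` be a domain with an
element `u ≠ 0` divisible by every power of `v`. If `ι : W ↪ Spec O` is an open immersion whose
image contains a point of `V(v)`, then `W` admits NO proper `π : Y → W` that is an isomorphism over
a dense open of `W` and has LOCALLY NOETHERIAN source — regular, log regular (toric) or otherwise.
Proof: `W` is integral with generic point `η_W ∈ U`; the point `η'` of `Y` over it specializes
(properness: `π` is closed) to some `x'` over the given point `w₀` of `V(v)`; the ring map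
`ψ : O → B = 𝒪_{Y,x'}` through `π ≫ ι` is local at `v` (`v ↦ 𝔪_B`) and injective (after
generization to `η'` it is a localization map of the domain `O` followed by the isomorphism
`(π ≫ ι).stalkMap η'`), so `ψ u ∈ ⋂ₙ 𝔪_Bⁿ = 0` (Krull's intersection theorem in the Noetherian
local ring `B`) contradicts `u ≠ 0`. Generalizes `not_hasResolution_Spec_of_forall_pow_dvd`
(`W = Spec O`, regular stalks). [folklore] -/
theorem no_noetherianModel_near_pinch {O : Type} [CommRing O] [IsDomain O]
    (u v : O) (hu : u ≠ 0) (hdvd : ∀ n : ℕ, v ^ n ∣ u)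
    {W : Scheme.{0}} (ι : W ⟶ Spec (.of O)) [IsOpenImmersion ι]
    (w₀ : W) (hw₀ : v ∈ (ι.base w₀).asIdeal)
    {Y : Scheme.{0}} (π : Y ⟶ W) [IsProper π] (hbir : IsBirational π)
    [IsLocallyNoetherian Y] : False := by
  obtain ⟨U, hUd, -, hUiso⟩ := hbir
  haveI := hUiso
  -- `W` is integral with generic point `ηW ∈ U`
  haveI : Nonempty W := ⟨w₀⟩
  haveI : IsIntegral (Spec (CommRingCat.of O)) := (affine_isIntegral_iff _).mpr inferInstance
  haveI : IsIntegral W := isIntegral_of_isOpenImmersion ι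
  let ηW : W := genericPoint W
  have hgen : ∀ w : W, ηW ⤳ w := genericPoint_specializes
  have hηU : ηW ∈ U := by
    obtain ⟨y, hy⟩ := hUd.nonempty
    exact U.isOpen.stableUnderGeneralization (hgen y) hy
  -- the point `η'` of `Y` over `ηW`
  let e := asIso (π ∣_ U)
  let z : ↥(π ⁻¹ᵁ U) := e.inv.base ⟨ηW, hηU⟩
  let η' : Y := z.1
  have hπη' : π.base η' = ηW := by
    have h1 : (π ∣_ U).base z = ⟨ηW, hηU⟩ := by
      show (e.inv ≫ e.hom).base ⟨ηW, hηU⟩ = ⟨ηW, hηU⟩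
      rw [e.inv_hom_id]; rfl
    have h2 := morphismRestrict_base_coe π U z
    rw [h1] at h2
    exact h2.symm
  -- `π` is closed, so some `x'` in the closure of `η'` maps to `w₀`
  obtain ⟨x', hx'cl, hx'm⟩ : w₀ ∈ π.base '' closure {η'} := by
    have hc : IsClosed (π.base '' closure {η'}) := π.isClosedMap _ isClosed_closure
    have hηm : π.base η' ⤳ w₀ := by rw [hπη']; exact hgen w₀
    exact hc.stableUnderSpecialization hηm ⟨η', subset_closure rfl, rfl⟩
  have hspec : η' ⤳ x' := specializes_iff_mem_closure.mpr hx'cl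
  -- the ring map `ψ : O → B = 𝒪_{Y,x'}` through `φ = π ≫ ι`
  let φ : Y ⟶ Spec (.of O) := π ≫ ι
  let sO : O →+* Γ(Spec (CommRingCat.of O), ⊤) := (Scheme.ΓSpecIso (CommRingCat.of O)).inv.hom
  let ψ : O →+* Y.presheaf.stalk x' :=
    (Y.presheaf.germ ⊤ x' trivial).hom.comp ((φ.appTop).hom.comp sO)
  have hψ : ∀ a, ψ a = Y.presheaf.germ ⊤ x' trivial (φ.appTop (sO a)) := fun a => rfl
  -- (i) `ψ v` is not a unit: `v` vanishes at `φ x' = ι w₀`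
  have hψv : ψ v ∈ IsLocalRing.maximalIdeal (Y.presheaf.stalk x') := by
    rw [IsLocalRing.mem_maximalIdeal, mem_nonunits_iff, hψ]
    intro hunit
    have hx'b : x' ∈ Y.basicOpen (φ.appTop (sO v)) := (Scheme.mem_basicOpen_top _ _ _).mpr hunit
    have key : φ ⁻¹ᵁ (Spec (CommRingCat.of O)).basicOpen (sO v) = Y.basicOpen (φ.appTop (sO v)) :=
      Scheme.preimage_basicOpen φ (sO v)
    rw [← key] at hx'b
    have hmb : φ.base x' ∈ (Spec (CommRingCat.of O)).basicOpen (sO v) := hx'b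
    have key' : (Spec (CommRingCat.of O)).basicOpen (sO v) = PrimeSpectrum.basicOpen v :=
      basicOpen_eq_of_affine (R := CommRingCat.of O) v
    have hφx' : φ.base x' = ι.base w₀ := by
      show ι.base (π.base x') = ι.base w₀
      rw [hx'm]
    rw [key', hφx'] at hmb
    exact hmb hw₀
  -- (ii) `ψ` is injective: after generization to `η'` it is a localization map of the domain `O`
  -- followed by the isomorphism `φ.stalkMap η'`
  have hψinj : Function.Injective ψ := by
    intro a b hab
    rw [hψ, hψ] at hab
    have hgen' := congrArg (Y.presheaf.stalkSpecializes hspec) hab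
    rw [TopCat.Presheaf.germ_stalkSpecializes_apply, TopCat.Presheaf.germ_stalkSpecializes_apply]
      at hgen'
    have key2 : ∀ y : Γ(Spec (CommRingCat.of O), ⊤),
        Y.presheaf.germ ⊤ η' trivial (φ.appTop y) =
          φ.stalkMap η' ((Spec (CommRingCat.of O)).presheaf.germ ⊤ (φ.base η') trivial y) :=
      fun y => (Scheme.Hom.germ_stalkMap_apply φ ⊤ η' trivial y).symm
    rw [key2, key2] at hgen'
    have hisoπ : IsIso (π.stalkMap η') :=
      ((MorphismProperty.isomorphisms CommRingCat).arrow_mk_iso_iff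
        (morphismRestrictStalkMap π U z)).mp (show IsIso ((π ∣_ U).stalkMap z) from inferInstance)
    have hισ : ∀ w : W, IsIso (ι.stalkMap w) := fun w => inferInstance
    have hiso : IsIso (φ.stalkMap η') := by
      rw [show φ.stalkMap η' = ι.stalkMap (π.base η') ≫ π.stalkMap η' from
        Scheme.Hom.stalkMap_comp π ι η']
      exact @IsIso.comp_isIso _ _ _ _ _ _ _ (hισ (π.base η')) hisoπ
    have hgen'' := (asIso (φ.stalkMap η')).commRingCatIsoToRingEquiv.injective hgen'
    have hloc : Function.Injective
        (algebraMap O ((Spec.structureSheaf O).presheaf.stalk (φ.base η'))) :=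
      IsLocalization.injective (M := (φ.base η').asIdeal.primeCompl) _
        (Ideal.primeCompl_le_nonZeroDivisors _)
    exact hloc hgen''
  -- (iii) Krull: `ψ u ∈ ⋂ₙ 𝔪_Bⁿ = 0`
  have hψu : ψ u ∈ (⨅ n : ℕ, IsLocalRing.maximalIdeal (Y.presheaf.stalk x') ^ n) := by
    refine Ideal.mem_iInf.mpr fun n => ?_
    obtain ⟨w, hw⟩ := hdvd n
    rw [hw, map_mul, map_pow]
    exact Ideal.mul_mem_right _ _ (Ideal.pow_mem_pow hψv n)
  have hbot := Ideal.iInf_pow_eq_bot_of_isLocalRing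
    (IsLocalRing.maximalIdeal (Y.presheaf.stalk x')) (IsLocalRing.maximalIdeal.isMaximal _).ne_top
  have h0 : ψ u = 0 := by simpa using hbot.le hψu
  exact hu (hψinj (h0.trans (map_zero ψ).symm))


/-! ## Gluing, keeping the glued-in piece in hand -/

section Glue

variable {P SO SA : Scheme.{0}} (j₁ : SA ⟶ P) (j₂ : SA ⟶ SO) [IsOpenImmersion j₁] [IsOpenImmersion j₂]

attribute [local instance] isOpenImmersion_span_map isOpenImmersion_pushout_inl
  isOpenImmersion_pushout_inr

/-- **Gluing with the piece in hand** (the datum of `exists_glued_of_not_hasResolution`, with the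
open immersion `ι_O : S_O ↪ X` and `ι_O ≫ f = g` exported instead of the conclusion about
resolutions): for integral `P`, `S_O`, non-empty `S_A`, open immersions `j₁ : S_A ↪ P`,
`j₂ : S_A ↪ S_O`, `g : S_O → P` with `j₂ ≫ g = j₁`, and an open `W ⊆ P` with `g⁻¹(W) ⊆ j₂(S_A)`,
the pushout `X = P ⨿_{S_A} S_O` with `f = 𝟙 ∪ g` is integral, `f` is surjective and an open
immersion over `W`, and `S_O ↪ X` is an open immersion over which `f` is `g`. [folklore] -/
theorem exists_glued_with_piece [IsIntegral P] [IsIntegral SO] [Nonempty ↥SA]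
    (g : SO ⟶ P) (hj : j₂ ≫ g = j₁) (W : P.Opens)
    (hW : ∀ q : ↥SO, g q ∈ W → q ∈ Set.range j₂) :
    ∃ (X : Scheme.{0}) (f : X ⟶ P) (ιO : SO ⟶ X), IsIntegral X ∧ Function.Surjective f.base ∧
      IsOpenImmersion (f ∣_ W) ∧ IsOpenImmersion ιO ∧ ιO ≫ f = g := by
  let X : Scheme.{0} := pushout j₁ j₂
  let ιP : P ⟶ X := pushout.inl j₁ j₂
  let ιO : SO ⟶ X := pushout.inr j₁ j₂
  have hcond : j₁ ≫ ιP = j₂ ≫ ιO := pushout.condition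
  let f : X ⟶ P := pushout.desc (𝟙 P) g (by rw [Category.comp_id, hj])
  have hιPf : ιP ≫ f = 𝟙 P := pushout.inl_desc _ _ _
  have hιOf : ιO ≫ f = g := pushout.inr_desc _ _ _
  have hcases : ∀ x : ↥X, (∃ y, ιP y = x) ∨ (∃ q, ιO q = x) := pushout_point_cases j₁ j₂
  refine ⟨X, f, ιO, ?_, ?_, ?_, inferInstance, hιOf⟩
  · -- integral: reduced (covered by reduced pieces) and irreducible (the pieces meet)
    haveI : IsReduced X := by
      refine Scheme.isReduced_of_forall_exists_isOpenImmersion fun x => ?_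
      rcases hcases x with ⟨y, rfl⟩ | ⟨q, rfl⟩
      · exact ⟨P, ιP, inferInstance, ⟨y, rfl⟩, inferInstance⟩
      · exact ⟨SO, ιO, inferInstance, ⟨q, rfl⟩, inferInstance⟩
    haveI : IrreducibleSpace ↥X := by
      let U : Bool → Set ↥X := fun b => cond b (Set.range ιP) (Set.range ιO)
      refine ProjectiveSpace.irreducibleSpace_of_iUnion_eq_univ U ?_ ?_ ?_ true ?_
      · refine Set.eq_univ_of_forall fun x => Set.mem_iUnion.mpr ?_
        rcases hcases x with ⟨y, rfl⟩ | ⟨q, rfl⟩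
        · exact ⟨true, y, rfl⟩
        · exact ⟨false, q, rfl⟩
      · rintro (_ | _)
        · exact ιO.isOpenEmbedding.isOpen_range
        · exact ιP.isOpenEmbedding.isOpen_range
      · rintro (_ | _)
        · simpa [U, Set.image_univ] using
            (IrreducibleSpace.isIrreducible_univ ↥SO).image _ ιO.continuous.continuousOn
        · simpa [U, Set.image_univ] using
            (IrreducibleSpace.isIrreducible_univ ↥P).image _ ιP.continuous.continuousOn
      · rintro (_ | _)
        · obtain ⟨a⟩ : Nonempty ↥SA := inferInstance
          refine ⟨ιO (j₂ a), ⟨j₂ a, rfl⟩, ⟨j₁ a, ?_⟩⟩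
          rw [← Scheme.Hom.comp_apply, hcond, Scheme.Hom.comp_apply]
        · obtain ⟨y⟩ : Nonempty ↥P := inferInstance
          exact ⟨ιP y, ⟨y, rfl⟩, ⟨y, rfl⟩⟩
    exact isIntegral_of_irreducibleSpace_of_isReduced _
  · -- surjective
    intro y
    refine ⟨ιP.base y, ?_⟩
    show (ιP ≫ f).base y = y
    rw [hιPf]
    rfl
  · -- open immersion over `W`: `f⁻¹ W` lies in the piece `P`, where `f` is the identity
    have hrange : Set.range (f ⁻¹ᵁ W).ι.base ⊆ Set.range ιP.base := by
      rintro _ ⟨x, rfl⟩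
      have hx : f x.1 ∈ W := x.2
      rcases hcases x.1 with ⟨y, hy⟩ | ⟨q, hq⟩
      · exact ⟨y, hy⟩
      · rw [← hq, ← Scheme.Hom.comp_apply, hιOf] at hx
        obtain ⟨a, ha⟩ := hW q hx
        refine ⟨j₁ a, ?_⟩
        show ιP (j₁ a) = x.1
        rw [← Scheme.Hom.comp_apply, hcond, Scheme.Hom.comp_apply, ha, hq]
    let l := IsOpenImmersion.lift ιP (f ⁻¹ᵁ W).ι hrange
    have hl : l ≫ ιP = (f ⁻¹ᵁ W).ι := IsOpenImmersion.lift_fac _ _ hrange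
    haveI : IsOpenImmersion l := by
      haveI : IsOpenImmersion (l ≫ ιP) := by rw [hl]; infer_instance
      exact IsOpenImmersion.of_comp l ιP
    have hfW : (f ∣_ W) ≫ W.ι = l := by
      rw [morphismRestrict_ι, ← hl, Category.assoc, hιPf, Category.comp_id]
    haveI : IsOpenImmersion ((f ∣_ W) ≫ W.ι) := by rw [hfW]; infer_instance
    exact IsOpenImmersion.of_comp (f ∣_ W) W.ι

end Glue

/-! ## Models over base opens: no locally Noetherian model over an open meeting the pinch -/

/-- **Transport of models along an open immersion into the target.** If `π : Y → T` is proper and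
birational with `Y` locally Noetherian and `e : V ↪ T` is an open immersion, then `V` too has a
proper birational model with locally Noetherian source (restrict `π` over the image of `e` and
compose with `e⁻¹`). [folklore] -/
theorem exists_noetherianModel_of_isOpenImmersion {Y T V : Scheme.{0}} (π : Y ⟶ T) [IsProper π]
    (hbir : IsBirational π) [IsLocallyNoetherian Y] (e : V ⟶ T) [IsOpenImmersion e] :
    ∃ (Y' : Scheme.{0}) (π' : Y' ⟶ V), IsProper π' ∧ IsBirational π' ∧ IsLocallyNoetherian Y' := by
  refine ⟨(π ⁻¹ᵁ e.opensRange : Scheme.{0}), (π ∣_ e.opensRange) ≫ e.isoOpensRange.inv,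
    inferInstance, (hbir.morphismRestrict e.opensRange).comp_iso e.isoOpensRange.inv,
    inferInstance⟩


/-! ## The pinch witness over a base open containing the pinch point -/

section PinchRing

set_option quotPrecheck false

variable (k : Type) [Field k]

local notation "𝓡" => MvPolynomial (Fin 2) k
local notation "𝓐" => Localization.Away (MvPolynomial.X 1 : MvPolynomial (Fin 2) k)
/-- the substitution `y₀ ↦ 0`, `y₁ ↦ y₁` -/
local notation "𝓚" => (MvPolynomial.aeval (R := k)
  (Fin.cons (0 : MvPolynomial (Fin 2) k) fun _ : Fin 1 => (MvPolynomial.X 1 : MvPolynomial (Fin 2) k)) :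
    MvPolynomial (Fin 2) k →ₐ[k] MvPolynomial (Fin 2) k)

attribute [local instance] isDomain_pinchA

/-- the endomorphism `ε : A → A`, `y₀ ↦ 0` -/
local notation "𝓔" => (IsLocalization.Away.lift (S := 𝓐) (MvPolynomial.X 1 : 𝓡)
  (g := RingHom.comp (algebraMap 𝓡 𝓐) (AlgHom.toRingHom 𝓚)) (pinch_isUnit k) : 𝓐 →+* 𝓐)
/-- **the pinch ring** `O = ε⁻¹(k[y₀,y₁]) = k[y₁] + y₀·A` -/
local notation "𝓞" => (Subring.comap 𝓔 (RingHom.range (algebraMap 𝓡 𝓐)) : Subring 𝓐)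
/-- `u = y₀ ∈ O` -/
local notation "𝓾" =>
  (Subtype.mk (algebraMap 𝓡 𝓐 (MvPolynomial.X 0)) (algebraMap_mem_pinch k (MvPolynomial.X 0)) : ↥𝓞)
/-- `v = y₁ ∈ O` -/
local notation "𝓿" =>
  (Subtype.mk (algebraMap 𝓡 𝓐 (MvPolynomial.X 1)) (algebraMap_mem_pinch k (MvPolynomial.X 1)) : ↥𝓞)

attribute [local instance] MvPolynomial.gradedAlgebra ProjBaseChange.algebraBase
  ProjBaseChange.isScalarTower_localization

/-- the chart ring map `k[y₀,y₁] → O` -/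
local notation "𝓹" => (RingHom.codRestrict (algebraMap 𝓡 𝓐) 𝓞 (algebraMap_mem_pinch k) : 𝓡 →+* ↥𝓞)
/-- `ℙ²_k` -/
local notation "𝓟" => (Comma.left (projectiveSpace 2 k) : Scheme.{0})
/-- the chart `Spec k[y₀,y₁] ≅ D₊(x₀) ↪ ℙ²_k` -/
local notation "𝓒" => (Spec.map (Iso.hom (RingEquiv.toCommRingCatIso (AlgEquiv.toRingEquiv
    (ProjectiveSpace.chartAlgEquiv k (0 : Fin (2 + 1)))))) ≫
  Proj.awayι (MvPolynomial.homogeneousSubmodule (Fin (2 + 1)) k) (MvPolynomial.X 0)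
    (ProjectiveSpace.X_mem 0) zero_lt_one : Spec (CommRingCat.of 𝓡) ⟶ 𝓟)
/-- `g : Spec O → Spec k[y₀,y₁] → ℙ²_k` -/
local notation "𝓰" => (Spec.map (CommRingCat.ofHom 𝓹) ≫ 𝓒 : Spec (CommRingCat.of ↥𝓞) ⟶ 𝓟)

/-- **The pinch point**: `v` lies in some prime of `O` (it is not a unit; in fact `V(v)` is the
single closed point `𝔪 = (y₁) + y₀·A`, with `O/vO = k`). [folklore] -/
theorem exists_pinchPoint : ∃ q₀ : ↥(Spec (CommRingCat.of ↥𝓞)), (𝓿 : ↥𝓞) ∈ q₀.asIdeal := by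
  obtain ⟨M, hM, hvM⟩ := Ideal.exists_le_maximal (Ideal.span {(𝓿 : ↥𝓞)})
    (fun h => pinch_not_isUnit_v k (Ideal.span_singleton_eq_top.mp h))
  exact ⟨⟨M, hM.isPrime⟩, hvM (Ideal.mem_span_singleton_self _)⟩

/-- The pinch point lies over the hyperplane at infinity: `g q₀ ∉ D₊(x₂)` whenever `v ∈ q₀`
(under the chart, `x₂/x₀ ↦ y₁ ↦ v`). [folklore] -/
theorem pinchPoint_not_mem_chart {q₀ : ↥(Spec (CommRingCat.of ↥𝓞))} (hq₀ : (𝓿 : ↥𝓞) ∈ q₀.asIdeal) :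
    𝓰 q₀ ∉ Proj.basicOpen (MvPolynomial.homogeneousSubmodule (Fin (2 + 1)) k)
      (MvPolynomial.X (Fin.last 2)) :=
  fun hq => pinch_v_not_mem_of_g_mem k hq hq₀

/-- **No locally Noetherian model over a base open containing the image of the pinch point.** For
ANY scheme `X` containing `Spec O` as an open piece `ι_O`, any morphism `f : X → T`, any point
`q₀ ∈ V(v)` of that piece and any open `B ⊆ T` containing `f(ι_O q₀)`: the open `f⁻¹(B) ⊆ X` has
no proper birational model with locally Noetherian source — in particular no resolution and no
log-regular (fs étale charts) model. (`no_noetherianModel_near_pinch` applied to the open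
`ι_O⁻¹ f⁻¹(B) ⊆ Spec O`, after transporting the model along the open immersion
`ι_O⁻¹ f⁻¹(B) ↪ f⁻¹(B)`.) [folklore] -/
theorem pinch_no_noetherianModel_over_open {X T : Scheme.{0}} (f : X ⟶ T)
    (ιO : Spec (CommRingCat.of ↥𝓞) ⟶ X) [IsOpenImmersion ιO]
    (q₀ : ↥(Spec (CommRingCat.of ↥𝓞))) (hq₀ : (𝓿 : ↥𝓞) ∈ q₀.asIdeal)
    (B : T.Opens) (hB : f (ιO q₀) ∈ B)
    {Y : Scheme.{0}} (π : Y ⟶ ((f ⁻¹ᵁ B : X.Opens) : Scheme.{0})) [IsProper π]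
    (hbir : IsBirational π) [IsLocallyNoetherian Y] : False := by
  -- transport the model to the open `V = ιO⁻¹ f⁻¹ B` of `Spec O`
  obtain ⟨Y', π', hπ', hbir', hN'⟩ :=
    exists_noetherianModel_of_isOpenImmersion π hbir (ιO ∣_ (f ⁻¹ᵁ B))
  haveI := hπ'
  haveI := hN'
  have hq₀V : q₀ ∈ ιO ⁻¹ᵁ (f ⁻¹ᵁ B) := hB
  exact no_noetherianModel_near_pinch 𝓾 𝓿 (pinch_u_ne_zero k) (pinch_v_pow_dvd_u k)
    (ιO ⁻¹ᵁ (f ⁻¹ᵁ B)).ι ⟨q₀, hq₀V⟩ hq₀ π' hbir'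

end PinchRing

/-! ## `IsFinite f` is load-bearing in the child / stub `BoundaryLogRegularization` (P1) -/

/-- **`IsFinite f` is load-bearing in `BoundaryLogRegularization`** (stub P1 =
`stub_boundaryLogRegularization` of line `strategy-split`, child 1/3 of the split of
`CoverResolution`): with the finiteness hypothesis deleted, P1 is FALSE. Witness: the pinch cover of
`coverResolution_false_without_isFinite` (`p = 2`, `k = 𝔽₂`, `n = 2`, `X = ℙ²_k ∪ Spec O`,
`O = k[y₁] + y₀·k[y₀,y₁,y₁⁻¹]`, `f = 𝟙 ∪ g`: integral, surjective, an open immersion over `D₊(x₂)`)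
and the point `h = f(𝔪) ∈ V₊(x₂)` under the pinch point `𝔪 ∋ v`: for EVERY open `B ∋ h` the open
`f⁻¹(B)` has no proper birational model with locally Noetherian source
(`pinch_no_noetherianModel_over_open`), let alone a log-regular one (a log regular atlas of fs étale
charts includes local Noetherianity, `EtaleLogAtlas.IsLogRegular.isLocallyNoetherian`). Moral for
the provers of P1: as for the crux itself, finiteness is needed exactly for Noetherianity of the
models upstairs; base-locality (`∃ B ∋ h`) buys nothing against a non-Noetherian point of `X` over
`H`. [folklore] -/
theorem boundaryLogRegularization_false_without_isFinite :
    ¬ (∀ p : ℕ, p.Prime → ∀ (k : Type) [Field k] [CharP k p] [PerfectField k] (n : ℕ)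
        (X : AlgebraicGeometry.Scheme.{0})
        (f : X ⟶ (Literature.AlgebraicGeometry.Motives.projectiveSpace n k).left),
        AlgebraicGeometry.IsIntegral X → Function.Surjective f.base →
        (letI := MvPolynomial.gradedAlgebra (σ := Fin (n + 1)) (R := k);
          AlgebraicGeometry.Etale (f ∣_ (AlgebraicGeometry.Proj.basicOpen
            (MvPolynomial.homogeneousSubmodule (Fin (n + 1)) k) (MvPolynomial.X (Fin.last n))))) →
        ∀ h : (Literature.AlgebraicGeometry.Motives.projectiveSpace n k).left,
        (letI := MvPolynomial.gradedAlgebra (σ := Fin (n + 1)) (R := k);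
          h ∉ AlgebraicGeometry.Proj.basicOpen (MvPolynomial.homogeneousSubmodule (Fin (n + 1)) k)
            (MvPolynomial.X (Fin.last n))) →
        ∃ B : (Literature.AlgebraicGeometry.Motives.projectiveSpace n k).left.Opens, h ∈ B ∧
          ∃ (Y : AlgebraicGeometry.Scheme.{0})
            (π : Y ⟶ ((f ⁻¹ᵁ B : X.Opens) : AlgebraicGeometry.Scheme.{0})),
            AlgebraicGeometry.IsProper π ∧ Literature.AlgebraicGeometry.Resolution.IsBirational π ∧
              Literature.AlgebraicGeometry.Resolution.Scheme.IsLogRegularEtale Y) := by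
  intro H
  letI := MvPolynomial.gradedAlgebra (σ := Fin (2 + 1)) (R := ZMod 2)
  haveI := isDomain_pinchA (ZMod 2)
  obtain ⟨X, f, ιO, hint, hsurj, hopen, hιO, hιOf⟩ :=
    @exists_glued_with_piece _ _ _ _ _ (isOpenImmersion_pinchj₁ (ZMod 2))
      (isOpenImmersion_pinchj₂ (ZMod 2)) (isIntegral_projectiveSpace 2 (ZMod 2))
      (isIntegral_Spec_pinch (ZMod 2)) (nonempty_Spec_pinchA (ZMod 2)) _ (pinch_hj (ZMod 2)) _
      (pinch_preimage_chart_subset_range (ZMod 2))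
  haveI := hopen
  haveI := hιO
  obtain ⟨q₀, hq₀⟩ := exists_pinchPoint (ZMod 2)
  have hh : f (ιO q₀) ∉ Proj.basicOpen (MvPolynomial.homogeneousSubmodule (Fin (2 + 1)) (ZMod 2))
      (MvPolynomial.X (Fin.last 2)) := by
    rw [← Scheme.Hom.comp_apply, hιOf]
    exact pinchPoint_not_mem_chart (ZMod 2) hq₀
  obtain ⟨B, hhB, Y, π, hπ, hbir, 𝒜, h𝒜⟩ :=
    H 2 Nat.prime_two (ZMod 2) 2 X f hint hsurj inferInstance (f (ιO q₀)) hh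
  haveI := hπ
  haveI := h𝒜.isLocallyNoetherian
  exact pinch_no_noetherianModel_over_open (ZMod 2) f ιO q₀ hq₀ B hhB π hbir

end Summit.ResolutionOfSingularities.ResolutionOfSingularities.Theorems.CoverResolution.Negative

end
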